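import Summits.Ventures.AbcSig.Recipes.FreyTraceLemma42
import Literature.NumberTheory.EllipticCurves.VariableChangePoints

/-!
# Venture AbcSig — `freyTrace` IS the trace of Frobenius of the PRINTED Frey curve [BS04, p. 27]

HONEST FRAMING. Elementary-arithmetic file of the COMPUTATION cell `pub-abcsig`; no Diophantine equation is solved, no hypothesis is
introduced, nothing is a claim on ABC or any summit. It pins the semantics of the one named hypothesis `NewformModel.FreyTracePackage`
(`Recipes/FreyTracePackage.lean`) to the curves AS PRINTED: the integer `freyTrace κ.model S q` that the package equates with `ψ(c_q(f))`
is `q + 1 − #E_κ(a,b,c)(𝔽_q)` for the curve `E_κ(a,b,c)` of [BS04, p. 27] written down literally.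

WHAT IS PROVED.
* `bs04Curve μ S q` — the printed curves over `ZMod q`: "`E₁(a,b,c): Y² = X³ + 2cC X² + BC bⁿ X`", "`E₂(a,b,c): Y² = X³ + cC X² +
  (BC bⁿ/4) X`", "`E₃(a,b,c): Y² + XY = X³ + ((cC − 1)/4) X² + (BC bⁿ/64) X`" (integer divisions).
* `FreyModel.Integral`, `FreyCase.integral_of_holds` — the case conditions (i)–(v) of [BS04, pp. 26–27] make the printed divisions
  exact (`4 ∣ B` in (iii)/(iv); `2⁶ ∣ B bⁿ` and `cC ≡ C² ≡ 1 (mod 4)` in (v), `C` being prime to the even `B b`).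
* `bs04Curve_E1_eq`, `bs04Curve_E2_eq` — over `ZMod q` (`q` odd prime) the printed `E₁`, `E₂` ARE the generator's curves
  `Conjectures.enumCurve` at the datum's residues `(bⁿ mod q, c mod q)` (`Recipes/KrausTable.lean`, `FreyModel.coeffs`);
  `completeSquare_bs04Curve_E3_eq` — for `E₃` the admissible change of variables `Y ↦ Y − X/2` (`completeSquare`) carries the printed
  curve to the generator's curve `Y² = X³ + (cC/4)X² + (BC bⁿ/64)X`.
* **`freyTrace_eq_trace`**, **`freyTrace_eq_trace_of_holds`** — hence, for `A aⁿ + B bⁿ = C c²` (resp. a primitive solution in case `κ`)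
  and an odd prime `q ∤ ABC·ab`: `freyTrace μ S q = q + 1 − Nat.card (E_μ(a,b,c) over ZMod q).Point` (Mathlib's points with `O`;
  the count is invariant under the change of variables by `Literature.NumberTheory.EllipticCurves.VariableChangePoints.pointEquiv`,
  and the generator's count is the cell's `Conjectures.traceNaive_eq_trace`).

References: [BS04] Bennett–Skinner, Canad. J. Math. 56 (2004), pp. 26–27 and Lemma 2.1; J. H. Silverman, *The Arithmetic of Elliptic
Curves*, III.1 (changes of variables; the tree's `VariableChangePoints`); cell records HOME/lit/BennettSkinner2004-asprinted.md §2.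
-/

namespace Summit.Ventures.AbcSig

open WeierstrassCurve

/-! ## The printed curves over `ZMod q` -/

/-- **The Frey curves of [BS04, p. 27], base-changed to `ZMod q`, LITERALLY:** "`E₁(a,b,c): Y² = X³ + 2cC X² + BC bⁿ X`"
(cases (i), (ii)), "`E₂(a,b,c): Y² = X³ + cC X² + (BC bⁿ/4) X`" (cases (iii), (iv)), "`E₃(a,b,c): Y² + XY = X³ +
((cC − 1)/4) X² + (BC bⁿ/64) X`" (case (v)), as Weierstrass data `⟨a₁, a₂, a₃, a₄, a₆⟩`; the divisions are integer divisions,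
exact under the case conditions (`FreyModel.Integral`). -/
def bs04Curve : FreyModel → FreyDatum → (q : ℕ) → WeierstrassCurve (ZMod q)
  | .E1, S, q => ⟨0, ((2 * S.c * S.C : ℤ) : ZMod q), 0, (((S.B : ℤ) * S.C * S.b ^ S.n : ℤ) : ZMod q), 0⟩
  | .E2, S, q => ⟨0, ((S.c * S.C : ℤ) : ZMod q), 0, (((S.B : ℤ) * S.C * S.b ^ S.n / 4 : ℤ) : ZMod q), 0⟩
  | .E3, S, q => ⟨1, (((S.c * S.C - 1) / 4 : ℤ) : ZMod q), 0, (((S.B : ℤ) * S.C * S.b ^ S.n / 64 : ℤ) : ZMod q), 0⟩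

/-- Exactness of the printed divisions: none for `E₁`; `4 ∣ BC bⁿ` for `E₂`; `4 ∣ cC − 1` and `64 ∣ BC bⁿ` for `E₃`. -/
def FreyModel.Integral : FreyModel → FreyDatum → Prop
  | .E1, _ => True
  | .E2, S => (4 : ℤ) ∣ (S.B : ℤ) * S.C * S.b ^ S.n
  | .E3, S => (4 : ℤ) ∣ S.c * S.C - 1 ∧ (64 : ℤ) ∣ (S.B : ℤ) * S.C * S.b ^ S.n

/-- **The case conditions make the printed divisions exact.** In case `κ` of [BS04, pp. 26–27], for a primitive solution,
`κ.model.Integral S`: (iii)/(iv) have `4 ∣ B`; (v) has `2⁶ ∣ B bⁿ` and `c ≡ C (mod 4)` with `C` odd (it is prime to the even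
`B b`), so `cC ≡ C² ≡ 1 (mod 4)`. -/
theorem FreyCase.integral_of_holds (κ : FreyCase) (S : FreyDatum) (hsol : IsPrimitiveSolution S.A S.B S.C S.n S.a S.b S.c)
    (hκ : κ.Holds S.A S.B S.C S.n S.a S.b S.c) : κ.model.Integral S := by
  obtain ⟨-, -, hBb, -, -, -, hbc⟩ := hsol
  cases κ with
  | i => trivial
  | iiB => trivial
  | iiC => trivial
  | iii₁ =>
    obtain ⟨-, ⟨h4, -⟩, -⟩ := hκ
    show (4 : ℤ) ∣ (S.B : ℤ) * S.C * S.b ^ S.n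
    exact (show (4 : ℤ) ∣ (S.B : ℤ) by simpa using h4).mul_right _ |>.mul_right _
  | iii₂ =>
    obtain ⟨-, ⟨h4, -⟩, -⟩ := hκ
    show (4 : ℤ) ∣ (S.B : ℤ) * S.C * S.b ^ S.n
    exact (show (4 : ℤ) ∣ (S.B : ℤ) by simpa using h4).mul_right _ |>.mul_right _
  | iv₃ =>
    obtain ⟨-, ⟨h8, -⟩, -⟩ := hκ
    show (4 : ℤ) ∣ (S.B : ℤ) * S.C * S.b ^ S.n
    have h4 : (4 : ℤ) ∣ (S.B : ℤ) := (show (4 : ℤ) ∣ 2 ^ 3 by norm_num).trans h8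
    exact (h4.mul_right _).mul_right _
  | iv₄₅ =>
    obtain ⟨-, h45, -⟩ := hκ
    show (4 : ℤ) ∣ (S.B : ℤ) * S.C * S.b ^ S.n
    have h4 : (4 : ℤ) ∣ (S.B : ℤ) := by
      rcases h45 with ⟨h, -⟩ | ⟨h, -⟩
      · exact (show (4 : ℤ) ∣ 2 ^ 4 by norm_num).trans h
      · exact (show (4 : ℤ) ∣ 2 ^ 5 by norm_num).trans h
    exact (h4.mul_right _).mul_right _
  | v₆ =>
    obtain ⟨⟨h64, -⟩, hcC⟩ := hκ
    exact integral_E3_aux S hBb hbc h64 hcC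
  | v₇ =>
    obtain ⟨h128, hcC⟩ := hκ
    exact integral_E3_aux S hBb hbc ((show (2 : ℤ) ^ 6 ∣ 2 ^ 7 by norm_num).trans h128) hcC
where
  /-- Case (v): `2⁶ ∣ B bⁿ` and `4 ∣ c − C` give the `E₃` integrality conditions. -/
  integral_E3_aux (S : FreyDatum) (hBb : (S.B : ℤ) * S.b ≠ 0) (hbc : IsCoprime ((S.B : ℤ) * S.b) ((S.C : ℤ) * S.c))
      (h64 : (2 : ℤ) ^ 6 ∣ (S.B : ℤ) * S.b ^ S.n) (hcC : (4 : ℤ) ∣ S.c - S.C) : FreyModel.E3.Integral S := by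
    constructor
    · -- `C` is odd: `2 ∣ B bⁿ` gives `2 ∣ B b` (or `n = 0`, impossible since then `64 ∣ B`... handled via primality of 2)
      have h2Bbn : (2 : ℤ) ∣ (S.B : ℤ) * S.b ^ S.n := (dvd_pow_self 2 (by norm_num)).trans h64
      have h2Bb : (2 : ℤ) ∣ (S.B : ℤ) * S.b ∨ (2 : ℤ) ∣ (S.B : ℤ) := by
        rcases Int.prime_two.dvd_mul.mp h2Bbn with h | h
        · exact Or.inr h
        · exact Or.inl (Dvd.dvd.mul_left (Int.prime_two.dvd_of_dvd_pow h) _)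
      have h2Bb' : (2 : ℤ) ∣ (S.B : ℤ) * S.b := by
        rcases h2Bb with h | h
        · exact h
        · exact h.mul_right _
      have hCodd : ¬ (2 : ℤ) ∣ (S.C : ℤ) := by
        intro h2C
        have hu := hbc.isUnit_of_dvd' h2Bb' (h2C.mul_right _)
        rcases Int.isUnit_iff.mp hu with h | h <;> omega
      -- `c ≡ C (mod 4)` and `C` odd ⇒ `cC ≡ C² ≡ 1 (mod 4)`
      obtain ⟨k, hk⟩ := hcC
      have hc : S.c = S.C + 4 * k := by omega
      rw [hc]
      have hCodd' : (S.C : ℤ) % 2 = 1 := by omega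
      have : ((S.C : ℤ) + 4 * k) * S.C - 1 = ((S.C : ℤ) * S.C - 1) + 4 * (k * S.C) := by ring
      rw [this]
      refine dvd_add ?_ (dvd_mul_right 4 _)
      have hC2 : ∃ m : ℤ, (S.C : ℤ) = 2 * m + 1 := ⟨(S.C : ℤ) / 2, by omega⟩
      obtain ⟨m, hm⟩ := hC2
      rw [hm]
      exact ⟨m * m + m, by ring⟩
    · have : (S.B : ℤ) * S.C * S.b ^ S.n = S.C * ((S.B : ℤ) * S.b ^ S.n) := by ring
      rw [this]
      exact (show (64 : ℤ) = 2 ^ 6 by norm_num) ▸ h64.mul_left _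

/-! ## Casting exact integer divisions into `ZMod q` -/

/-- If `d ∣ x` in `ℤ` and `d` is invertible in `ZMod q` with inverse `i`, then `x / d` casts to `x · i`. -/
theorem intCast_ediv_of_dvd {q : ℕ} [Fact q.Prime] {d x : ℤ} (hdx : d ∣ x) {i : ZMod q} (hi : (d : ZMod q) * i = 1) :
    ((x / d : ℤ) : ZMod q) = (x : ZMod q) * i := by
  obtain ⟨k, rfl⟩ := hdx
  have hd0 : d ≠ 0 := by
    rintro rfl
    rw [Int.cast_zero, zero_mul] at hi
    exact zero_ne_one hi
  rw [Int.mul_ediv_cancel_left k hd0]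
  push_cast
  rw [mul_comm ((d : ZMod q)) (k : ZMod q), mul_assoc, hi, mul_one]

/-- Powers of `2` are invertible modulo an odd prime, with the generator's inverse `invModP q (2^k)`. -/
theorem mul_invModP_pow_two {q : ℕ} [Fact q.Prime] (hq2 : q ≠ 2) (k : ℕ) :
    (2 : ZMod q) ^ k * ((invModP q (2 ^ k) : ℕ) : ZMod q) = 1 := by
  have h2 : ((2 ^ k : ℕ) : ZMod q) ≠ 0 := by
    rw [Nat.cast_pow, Nat.cast_ofNat]
    exact pow_ne_zero _ (Ring.two_ne_zero (show ringChar (ZMod q) ≠ 2 by rw [ZMod.ringChar_zmod_n]; exact hq2))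
  have h := Conjectures.mul_invModP h2
  rwa [Nat.cast_pow, Nat.cast_ofNat] at h

/-! ## The printed curves ARE the generator's curves at the datum's residues -/

/-- `E₁`: the printed curve over `ZMod q` is literally the generator's curve at `(bⁿ mod q, c mod q)`. -/
theorem bs04Curve_E1_eq (S : FreyDatum) {q : ℕ} (hq : q ≠ 0) :
    bs04Curve .E1 S q = Conjectures.enumCurve .E1 q S.B S.C (Int.toNat ((S.b ^ S.n) % (q : ℤ))) (Int.toNat (S.c % (q : ℤ))) := by
  haveI : NeZero q := ⟨hq⟩
  simp only [bs04Curve, Conjectures.enumCurve, FreyModel.coeffs]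
  ext <;> dsimp only
  case a₂ => rw [ZMod.natCast_mod]; push_cast; rw [natCast_toNat_emod _ hq]
  case a₄ => rw [ZMod.natCast_mod]; push_cast; rw [natCast_toNat_emod _ hq, Int.cast_pow]

/-- `E₂`: the printed curve over `ZMod q` (`q` an odd prime, `4 ∣ BC bⁿ`) is the generator's curve at `(bⁿ mod q, c mod q)`. -/
theorem bs04Curve_E2_eq (S : FreyDatum) {q : ℕ} [Fact q.Prime] (hq2 : q ≠ 2) (hint : FreyModel.E2.Integral S) :
    bs04Curve .E2 S q = Conjectures.enumCurve .E2 q S.B S.C (Int.toNat ((S.b ^ S.n) % (q : ℤ))) (Int.toNat (S.c % (q : ℤ))) := by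
  have hq : q ≠ 0 := (Fact.out : q.Prime).ne_zero
  have hi4 : ((4 : ℤ) : ZMod q) * ((invModP q 4 : ℕ) : ZMod q) = 1 := by
    have h := mul_invModP_pow_two hq2 2
    norm_num at h
    exact_mod_cast h
  simp only [bs04Curve, Conjectures.enumCurve, FreyModel.coeffs]
  ext <;> dsimp only
  case a₂ => rw [ZMod.natCast_mod]; push_cast; rw [natCast_toNat_emod _ hq]
  case a₄ => rw [ZMod.natCast_mod, intCast_ediv_of_dvd hint hi4]; push_cast; rw [natCast_toNat_emod _ hq, Int.cast_pow]

/-- The change of variables `Y ↦ Y − X/2` (`u = 1, r = 0, s = −1/2, t = 0`) completing the square in `E₃`. -/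
def completeSquare (q : ℕ) : VariableChange (ZMod q) := ⟨1, 0, -((invModP q 2 : ℕ) : ZMod q), 0⟩

/-- `E₃`: completing the square in the printed curve over `ZMod q` (`q` an odd prime, `4 ∣ cC − 1`, `64 ∣ BC bⁿ`) gives the
generator's curve at `(bⁿ mod q, c mod q)`: `Y² + XY = X³ + ((cC − 1)/4)X² + a₄X` ↦ `Y² = X³ + (cC/4)X² + a₄X`. -/
theorem completeSquare_bs04Curve_E3_eq (S : FreyDatum) {q : ℕ} [Fact q.Prime] (hq2 : q ≠ 2) (hint : FreyModel.E3.Integral S) :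
    completeSquare q • bs04Curve .E3 S q =
      Conjectures.enumCurve .E3 q S.B S.C (Int.toNat ((S.b ^ S.n) % (q : ℤ))) (Int.toNat (S.c % (q : ℤ))) := by
  have hq : q ≠ 0 := (Fact.out : q.Prime).ne_zero
  obtain ⟨hcC, h64⟩ := hint
  have hi2 : (2 : ZMod q) * ((invModP q 2 : ℕ) : ZMod q) = 1 := by
    have h := mul_invModP_pow_two hq2 1
    norm_num at h
    exact h
  have hi4' : (4 : ZMod q) * ((invModP q 4 : ℕ) : ZMod q) = 1 := by
    have h := mul_invModP_pow_two hq2 2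
    norm_num at h
    exact h
  have hi4 : ((4 : ℤ) : ZMod q) * ((invModP q 4 : ℕ) : ZMod q) = 1 := by exact_mod_cast hi4'
  have hi64 : ((64 : ℤ) : ZMod q) * ((invModP q 64 : ℕ) : ZMod q) = 1 := by
    have h := mul_invModP_pow_two hq2 6
    norm_num at h
    exact_mod_cast h
  -- `i2² = i4` (both invert `4`) and hence `i2 = 2·i4`, where `i2 = 2⁻¹`, `i4 = 4⁻¹`
  have hsq : ((invModP q 2 : ℕ) : ZMod q) ^ 2 = ((invModP q 4 : ℕ) : ZMod q) := by
    have h1 : (4 : ZMod q) * ((invModP q 2 : ℕ) : ZMod q) ^ 2 = 1 := by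
      linear_combination (2 * ((invModP q 2 : ℕ) : ZMod q) + 1) * hi2
    have h4ne : (4 : ZMod q) ≠ 0 := fun h => by rw [h, zero_mul] at hi4'; exact zero_ne_one hi4'
    exact mul_left_cancel₀ h4ne (h1.trans hi4'.symm)
  have hmain : ((invModP q 2 : ℕ) : ZMod q) = 2 * ((invModP q 4 : ℕ) : ZMod q) := by
    calc ((invModP q 2 : ℕ) : ZMod q) = ((invModP q 2 : ℕ) : ZMod q) * ((2 : ZMod q) * ((invModP q 2 : ℕ) : ZMod q)) := by
          rw [hi2, mul_one]
      _ = 2 * ((invModP q 2 : ℕ) : ZMod q) ^ 2 := by ring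
      _ = 2 * ((invModP q 4 : ℕ) : ZMod q) := by rw [hsq]
  simp only [bs04Curve, Conjectures.enumCurve, FreyModel.coeffs, completeSquare, variableChange_def, inv_one, Units.val_one,
    one_pow, one_mul]
  ext <;> dsimp only
  case a₁ => linear_combination (-1 : ZMod q) * hi2
  case a₂ =>
    rw [intCast_ediv_of_dvd hcC hi4, ZMod.natCast_mod]
    push_cast
    rw [natCast_toNat_emod _ hq]
    linear_combination hmain - hsq
  case a₃ => ring
  case a₄ =>
    rw [intCast_ediv_of_dvd h64 hi64, ZMod.natCast_mod]
    push_cast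
    rw [natCast_toNat_emod _ hq, Int.cast_pow]
    ring
  case a₆ => ring

/-! ## `freyTrace` is the trace of Frobenius of the printed curve -/

/-- **`freyTrace μ S q` IS `a_q(E_μ(a, b, c))`.** For `A aⁿ + B bⁿ = C c²`, an odd prime `q` dividing none of `A, B, C, a, b`,
and a model `μ` whose printed divisions are exact for the datum (`μ.Integral S` — automatic for the model of the case the datum is
in, `FreyCase.integral_of_holds`), the printed curve `E_μ(a, b, c)` of [BS04, p. 27] over `ZMod q` has
`q + 1 − #E_μ(a,b,c)(ZMod q) = freyTrace μ S q` (points counted with the point at infinity, Mathlib's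
`WeierstrassCurve.Affine.Point`). For `E₁, E₂` the printed curve IS the generator's curve (`bs04Curve_E1_eq`, `bs04Curve_E2_eq`);
for `E₃` they differ by the completion of the square `Y ↦ Y − X/2`, which preserves the number of points
(`Literature…VariableChangePoints.pointEquiv`). The point count of the generator's curve is the cell's
`Conjectures.traceNaive_eq_trace` (Euler's criterion + the tree's point-count identity). -/
theorem freyTrace_eq_trace (μ : FreyModel) (S : FreyDatum) {q : ℕ} [Fact q.Prime] (hq2 : q ≠ 2)
    (heq : (S.A : ℤ) * S.a ^ S.n + S.B * S.b ^ S.n = S.C * S.c ^ 2)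
    (hA : ¬ (q : ℤ) ∣ S.A) (hB : ¬ q ∣ S.B) (hC : ¬ q ∣ S.C) (ha : ¬ (q : ℤ) ∣ S.a) (hb : ¬ (q : ℤ) ∣ S.b)
    (hint : μ.Integral S) :
    freyTrace μ S q = (q : ℤ) + 1 - (Nat.card (bs04Curve μ S q).toAffine.Point : ℤ) := by
  have hq : q ≠ 0 := (Fact.out : q.Prime).ne_zero
  haveI := isElliptic_enumCurve_datum μ S hq2 heq hA hB hC ha hb
  have h1 : freyTrace μ S q = (q : ℤ) + 1 -
      (Nat.card (Conjectures.enumCurve μ q S.B S.C (Int.toNat ((S.b ^ S.n) % (q : ℤ)))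
        (Int.toNat (S.c % (q : ℤ)))).toAffine.Point : ℤ) :=
    Conjectures.traceNaive_eq_trace hq2 _ _
      (Conjectures.enumCurve μ q S.B S.C (Int.toNat ((S.b ^ S.n) % (q : ℤ))) (Int.toNat (S.c % (q : ℤ)))) rfl rfl rfl rfl rfl
  cases μ with
  | E1 => rw [bs04Curve_E1_eq S hq]; exact h1
  | E2 => rw [bs04Curve_E2_eq S hq2 hint]; exact h1
  | E3 =>
    rw [h1, Nat.card_congr (WeierstrassCurve.VariableChange.pointEquiv (bs04Curve .E3 S q) (completeSquare q)).toEquiv,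
      completeSquare_bs04Curve_E3_eq S hq2 hint]

/-- **In the case of the datum.** For a primitive solution in case `κ` of [BS04, pp. 26–27] and an odd prime `q ∤ ABC·ab`:
`freyTrace κ.model S q = q + 1 − #E_κ(a, b, c)(ZMod q)` — the integer that `NewformModel.FreyTracePackage` equates with `ψ(c_q(f))`
is the trace of Frobenius of THE printed Frey curve of the case. -/
theorem freyTrace_eq_trace_of_holds (κ : FreyCase) (S : FreyDatum) {q : ℕ} [Fact q.Prime] (hq2 : q ≠ 2)
    (hsol : IsPrimitiveSolution S.A S.B S.C S.n S.a S.b S.c) (hκ : κ.Holds S.A S.B S.C S.n S.a S.b S.c)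
    (hA : ¬ (q : ℤ) ∣ S.A) (hB : ¬ q ∣ S.B) (hC : ¬ q ∣ S.C) (ha : ¬ (q : ℤ) ∣ S.a) (hb : ¬ (q : ℤ) ∣ S.b) :
    freyTrace κ.model S q = (q : ℤ) + 1 - (Nat.card (bs04Curve κ.model S q).toAffine.Point : ℤ) :=
  freyTrace_eq_trace κ.model S hq2 hsol.1 hA hB hC ha hb (κ.integral_of_holds S hsol hκ)

end Summit.Ventures.AbcSig
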